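import HarnessLib
import Summits.RiemannHypothesis.RiemannHypothesis.Theorems.SignConePointwiseCertSevenFifths
import Summits.RiemannHypothesis.RiemannHypothesis.Theorems.SignConePointwiseIdentityH
import Summits.RiemannHypothesis.RiemannHypothesis.Theorems.SignConeUnitSlackReduction

/-!
# Route SignCone: the unit-slack sign-cone inequality UNCONDITIONALLY up to the cut-off `a ≤ 7/5`

Items stmt-RiemannHypothesis-16302 `SignConeOscillatory` (crux) and stmt-RiemannHypothesis-16301
`SignConeInequality` (target). Rung at `a ≤ 7/5` — window `(-2.8, 2.8)` — from
the kernel-checked pointwise certificate WITH DIRICHLET-SOS TAIL `pwCert75`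
(`SignConePointwiseCertSevenFifths*.lean`): fake weights `a = (0.4359, 1.0187, 0.2315, 0.5811, 0.4202, 0.7196, 0.5420, 0.5927, 0.5313, 0.3156, 0.6161, 0.5155, 0.4398)` on the nodes `3, 4, 5, 6, 7, 8, 9, 10, 11, 12, 13, 14, 15`
(`c_n = a_n √n / 2`, a point of the dual cone `K♭_{7/5}`), whence the antecedent of
`ConeMagnification` at the cutoff `b = 7/5` (`fakeWeight_unitSlack_seven_fifths`) and, by
`SignConeUnitSlackReduction.lean`, the route items for all `a ≤ 7/5`
(`signConeInequality_upTo_seven_fifths`, `signConeOscillatory_upTo_seven_fifths`, bodies verbatim).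
-/

noncomputable section

-- `Summit.RiemannHypothesis.RiemannHypothesis.…` repeats a namespace component by design (D-0017 layout).
set_option linter.dupNamespace false
-- the certificate data (`pwCert75sos`: 38 × 60 integer Gram rows) is a deep term
set_option maxRecDepth 16384

open scoped BigOperators ComplexConjugate
open Complex MeasureTheory Set Filter

namespace Summit.RiemannHypothesis.RiemannHypothesis.Theorems.SignCone

open Literature.NumberTheory.LFunctions

/-- The weights vanish off the node list `[3, 4, 5, 6, 7, 8, 9, 10, 11, 12, 13, 14, 15]`. [folklore] -/
theorem pwCert75_a_eq_zero {n : ℕ} (hn : n ∉ pwCert75.nodeList.toFinset) : pwCert75.a n = 0 := by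
  have hn' : n ∉ ([3, 4, 5, 6, 7, 8, 9, 10, 11, 12, 13, 14, 15] : List ℕ) := fun h => hn (List.mem_toFinset.2 h)
  simp only [List.mem_cons, List.mem_nil_iff, or_false, not_or] at hn'
  obtain ⟨h3, h4, h5, h6, h7, h8, h9, h10, h11, h12, h13, h14, h15⟩ := hn'
  have e : pwCert75.a n = (if n = 3 then 43591/100000 else if n = 4 then 101871/100000 else if n = 5 then 23153/100000 else if n = 6 then 58109/100000 else if n = 7 then 42019/100000 else if n = 8 then 17991/25000 else if n = 9 then 54203/100000 else if n = 10 then 2371/4000 else if n = 11 then 6641/12500 else if n = 12 then 31563/100000 else if n = 13 then 61611/100000 else if n = 14 then 51553/100000 else if n = 15 then 2749/6250 else 0 : ℚ) := rfl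
  rw [e, if_neg h3, if_neg h4, if_neg h5, if_neg h6, if_neg h7, if_neg h8, if_neg h9, if_neg h10, if_neg h11, if_neg h12,
    if_neg h13, if_neg h14, if_neg h15]

/-- The fake weights of the certificate are non-negative (`c_n = a_n √n / 2`). [folklore] -/
theorem pwCert75_a_nonneg (n : ℕ) : 0 ≤ pwCert75.a n := by
  by_cases hn : n ∈ pwCert75.nodeList.toFinset
  · have hall : (pwCert75.nodeList.all fun k => decide (0 ≤ pwCert75.a k)) = true := by decide +kernel
    rw [List.all_eq_true] at hall
    exact of_decide_eq_true (hall n (List.mem_toFinset.1 hn))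
  · rw [pwCert75_a_eq_zero hn]

/-- **The antecedent of `ConeMagnification` at cut-off `7/5` with an explicit fake weight**:
`-‖g‖₂² ≤ Re (W_ar(g ⋆ g̃) − P_c(g ⋆ g̃))` for every Weil test `g` supported in `[-7/5, 7/5]`, with
`c_n = a_n √n/2` on `n ∈ {3, …, 15}` (kernel-checked pointwise certificate `pwCert75`). [folklore] -/
theorem fakeWeight_unitSlack_seven_fifths :
    ∀ g : ℝ → ℂ, IsWeilTest g → tsupport g ⊆ Icc (-(7 / 5 : ℝ)) (7 / 5) →
      -(∫ t, ‖g t‖ ^ 2) ≤ (weilPolarTerm (weilConv g (weilReflect g)) + weilArchTerm (weilConv g (weilReflect g)) -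
        ∑' n : ℕ, (((fun n : ℕ => (pwCert75.a n : ℝ) * Real.sqrt n / 2) n : ℝ) : ℂ) / (Real.sqrt n : ℂ) *
          (weilConv g (weilReflect g) (Real.log n) + weilConv g (weilReflect g) (-Real.log n))).re := by
  intro g hg hsupp
  have hh : (0 : ℚ) < pwCert75.d.h := by show (0 : ℚ) < 1/8; norm_num
  have hL : pwCert75.d.L = 14 / 5 := rfl
  -- the kernel of the certificate on the window [-2.8, 2.8]
  have hEeq : ∀ x ∈ Icc (-(2 * (7 / 5 : ℝ))) (2 * (7 / 5)),
      pwCert75.d.kernelE x = Real.exp (x / 2) + Real.exp (-(x / 2)) := by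
    intro x hx
    refine PWKernel.kernelE_eq_of_abs_le hh ?_
    rw [hL]; push_cast
    exact abs_le.2 ⟨by linarith [hx.1], by linarith [hx.2]⟩
  -- the corrected pointwise certificate `F + Hsos ≥ 0` and the frequencies of `Hsos`
  have hF : ∀ y : ℝ, 0 ≤ Literature.Analysis.SpecialFunctions.reDigammaQuarter y - Real.log Real.pi +
      ((pwCert75.s : ℚ) : ℝ) + cosTransform pwCert75.d.kernelE y -
        ∑ n ∈ pwCert75.nodeList.toFinset, (fun n : ℕ => ((pwCert75.a n : ℚ) : ℝ)) n * Real.cos (y * Real.log n) +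
        pwCert75sos.Hsos y :=
    pwCert75_FH_nonneg
  have hfreq : ∀ pq ∈ ratioClasses pwCert75sos.Np, pwCert75sos.isOut pq.1 pq.2 = true →
      2 * (7 / 5 : ℝ) < |Real.log pq.1 - Real.log pq.2| := by
    intro pq hpq hout
    have h1 := SOSData.Hsos_frequencies pwCert75_sos hpq hout
    have e : ((pwCert75.d.L : ℚ) : ℝ) = 2 * (7 / 5 : ℝ) := by rw [hL]; push_cast; ring
    rw [e] at h1
    exact h1
  have hs : ((pwCert75.s : ℚ) : ℝ) = 1 := by show (((1 : ℚ)) : ℝ) = 1; norm_num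
  have h := neg_slack_le_of_density_add_Hsos_nonneg hg hsupp (PWKernel.continuous_kernelE _)
    (PWKernel.hasCompactSupport_kernelE hh) hEeq ((pwCert75.s : ℚ) : ℝ) pwCert75.nodeList.toFinset
    (fun n : ℕ => ((pwCert75.a n : ℚ) : ℝ)) pwCert75sos hfreq hF
  rw [hs, one_mul] at h
  -- the finite sum as the `tsum` of the route form
  have hts : (∑' n : ℕ, (((fun n : ℕ => (pwCert75.a n : ℝ) * Real.sqrt n / 2) n : ℝ) : ℂ) / (Real.sqrt n : ℂ) *
      (weilConv g (weilReflect g) (Real.log n) + weilConv g (weilReflect g) (-Real.log n))) =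
      ∑ n ∈ pwCert75.nodeList.toFinset, (((pwCert75.a n : ℚ) : ℝ) / 2 : ℝ) *
        (weilConv g (weilReflect g) (Real.log n) + weilConv g (weilReflect g) (-Real.log n)) := by
    have hpt : ∀ n : ℕ, (((fun n : ℕ => (pwCert75.a n : ℝ) * Real.sqrt n / 2) n : ℝ) : ℂ) / (Real.sqrt n : ℂ) =
        ((((pwCert75.a n : ℚ) : ℝ) / 2 : ℝ) : ℂ) := by
      intro n
      rcases Nat.eq_zero_or_pos n with rfl | hn
      · have h0 : pwCert75.a 0 = 0 := pwCert75_a_eq_zero (by decide)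
        simp [h0]
      · have hsq : (Real.sqrt n : ℂ) ≠ 0 := by
          exact_mod_cast (Real.sqrt_pos.2 (by exact_mod_cast hn)).ne'
        field_simp
        push_cast
        ring
    simp_rw [hpt]
    refine tsum_eq_sum fun n hn => ?_
    rw [pwCert75_a_eq_zero hn]
    push_cast
    ring
  rw [hts]
  exact h

/-- The fake weights are non-negative. [folklore] -/
theorem fakeWeight_seven_fifths_nonneg (n : ℕ) : 0 ≤ (pwCert75.a n : ℝ) * Real.sqrt n / 2 := by
  have := pwCert75_a_nonneg n
  have h1 : (0 : ℝ) ≤ pwCert75.a n := by exact_mod_cast this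
  positivity

/-- **The unit-slack sign-cone inequality up to `7/5`, Literature form.** For every finite family of Weil
tests `gᵢ` supported in `[-b, b]`, `b ≤ 7/5`, and `F = Σᵢ gᵢ ⋆ g̃ᵢ` node-nonnegative:
`-Re F(0) ≤ Re W_ar(F)`. [folklore] -/
theorem neg_re_apply_zero_le_re_weilArchPolar_of_tsupport_subset_seven_fifths {b : ℝ} (hb : b ≤ 7 / 5)
    {k : ℕ} {g : Fin k → ℝ → ℂ} {F : ℝ → ℂ} (hF : F = fun t => ∑ i, weilConv (g i) (weilReflect (g i)) t)
    (hg : ∀ i, IsWeilTest (g i)) (hsupp : ∀ i, tsupport (g i) ⊆ Icc (-b) b)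
    (hn : ∀ n : ℕ, 2 ≤ n → 0 ≤ (F (Real.log n)).re) :
    -(F 0).re ≤ (weilPolarTerm F + weilArchTerm F).re :=
  neg_re_apply_zero_le_re_weilArchPolar_of_fakeWeight_unitSlack (b := 7 / 5)
    (c := fun n : ℕ => (pwCert75.a n : ℝ) * Real.sqrt n / 2) fakeWeight_seven_fifths_nonneg fakeWeight_unitSlack_seven_fifths hF hg
    (fun i => (hsupp i).trans (Icc_subset_Icc (neg_le_neg hb) hb)) hn

/-- **`SignConeInequality` (route target, stmt-RiemannHypothesis-16301) UNCONDITIONALLY for all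
cut-offs `a ≤ 7/5`** — the item's body verbatim with the extra hypothesis `a ≤ 7/5`. [folklore] -/
theorem signConeInequality_upTo_seven_fifths :
    ∀ a : ℝ, 0 < a → a ≤ 7 / 5 → ∀ (k : ℕ) (g : Fin k → ℝ → ℂ), (∀ i, (ContDiff ℝ ((⊤ : ℕ∞) : WithTop ℕ∞) (g i) ∧ HasCompactSupport (g i)) ∧ tsupport (g i) ⊆ Set.Icc (-a) a) → let F : ℝ → ℂ := fun t => ∑ i, MeasureTheory.convolution (g i) (fun u => (starRingEnd ℂ) ((g i) (-u))) (ContinuousLinearMap.mul ℂ ℂ) MeasureTheory.MeasureSpace.volume t; (∀ n : ℕ, 2 ≤ n → 0 ≤ (F (Real.log n)).re) → let M : ℂ → ℂ := fun s => ∫ u : ℝ, F u * Complex.exp ((s - 1 / 2) * u); -(F 0).re ≤ (M 0 + M 1 + ((1 / (2 * Real.pi) : ℂ) * (∫ t : ℝ, M (1 / 2 + t * Complex.I) * ((Complex.digamma (1 / 4 + t / 2 * Complex.I)).re : ℂ)) - F 0 * (Real.log Real.pi : ℂ))).re := by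
  intro a _ha hab k g hg F hn M
  exact neg_re_apply_zero_le_re_weilArchPolar_of_tsupport_subset_seven_fifths (b := a) hab (g := g) (F := F)
    rfl (fun i => (hg i).1) (fun i => (hg i).2) hn

/-- **`SignConeOscillatory` (route crux, stmt-RiemannHypothesis-16302) UNCONDITIONALLY for all
cut-offs `a ≤ 7/5`** — the item's body verbatim with the extra hypothesis `a ≤ 7/5` (previous
rungs: `563/1024` exact cone, `4/5` without primes, `1` and `13/10` with fake primes). [folklore] -/
theorem signConeOscillatory_upTo_seven_fifths :
    ∀ a : ℝ, 0 < a → a ≤ 7 / 5 → ∀ (k : ℕ) (g : Fin k → ℝ → ℂ), (∀ i, (ContDiff ℝ ((⊤ : ℕ∞) : WithTop ℕ∞) (g i) ∧ HasCompactSupport (g i)) ∧ tsupport (g i) ⊆ Set.Icc (-a) a) → let F : ℝ → ℂ := fun t => ∑ i, MeasureTheory.convolution (g i) (fun u => (starRingEnd ℂ) ((g i) (-u))) (ContinuousLinearMap.mul ℂ ℂ) MeasureTheory.MeasureSpace.volume t; (∀ n : ℕ, 2 ≤ n → 0 ≤ (F (Real.log n)).re) → (∃ t : ℝ, Real.log 2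 ≤ |t| ∧ (F t).re < 0) → let M : ℂ → ℂ := fun s => ∫ u : ℝ, F u * Complex.exp ((s - 1 / 2) * u); -(F 0).re ≤ (M 0 + M 1 + ((1 / (2 * Real.pi) : ℂ) * (∫ t : ℝ, M (1 / 2 + t * Complex.I) * ((Complex.digamma (1 / 4 + t / 2 * Complex.I)).re : ℂ)) - F 0 * (Real.log Real.pi : ℂ))).re :=
  signConeOscillatory_upTo_of_fakeWeight_unitSlack (b := 7 / 5)
    (c := fun n : ℕ => (pwCert75.a n : ℝ) * Real.sqrt n / 2) fakeWeight_seven_fifths_nonneg fakeWeight_unitSlack_seven_fifths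

end Summit.RiemannHypothesis.RiemannHypothesis.Theorems.SignCone

end
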